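import Summits.BirchSwinnertonDyer.BirchSwinnertonDyer.Theses.BiquadraticEisensteinDescent
import Summits.BirchSwinnertonDyer.BirchSwinnertonDyer.Theses.PadicCornerSqueeze
import Summits.BirchSwinnertonDyer.Rank1Residual.WAll.AltClosersManinCells
import Literature.NumberTheory.EllipticCurves.CuspFormLFunction
import HarnessLib

/-!
# Route `BiquadraticEisensteinDescent` (BED), item stmt-BirchSwinnertonDyer-19216 `ModularityNewformExists`:
# the displayed input «modularity, stated inline» IS the displayed input «modularity, by name»
# (item 19382 `NewformOfEllipticCurve := exists_isNewformOf`) — definitionally — and is already a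
# conjunct of the route's binder `PublishedInputsBiquadratic` (item 20243)

Cell `pub/bsd-wall/bsd-inputs`, D-0154 (2) INPUTS → UNCONDITIONAL, row BED p3 («B19 reduce» of
`INPUTS-LIST-1.md` §1B/§1C), seat `bsd-inputs-bed-p3` g0. A `--supports stmt-BirchSwinnertonDyer-19216` file.

WHAT.  The route's crux `ManinDatumFiveSevenCMInert` (item 20242, binder `h5` of `closes`) is SPLIT into
`MazurManinOdd`, `AbbesUllmoManinGood`, `CesnaviciusManinTwo`, `ModularityNewformExists` (item 19216),
`ManinDatumSupercuspidalCMInert` + glue `ManinDatumFiveSevenCMInertOfParts` (item 20114, landed: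
`maninDatumFiveSevenCMInertOfParts_holds`, one line over the Theses-free alt-closer
`WAll.maninDatumFiveSevenCMInert_of_facts_of_supercuspidalResidual`, which this file re-uses — no Theorems module
that imports the route file is imported here). The child `ModularityNewformExists` is the Modularity Theorem,
Version `L` (Breuil–Conrad–Diamond–Taylor 2001 Thm. A; Diamond–Shurman 2005 Thm. 8.8.3) written out INLINE:
`∀ W [IsElliptic] [NeZero N_W], ∃ f : S₂(Γ₀(N_W)), IsNewformOf W f` — which is VERBATIM the body of the
Literature named fact `ModularForms.exists_isNewformOf` (`CuspFormLFunction.lean`), itself displayed BY NAME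
as the route's item 19382 `NewformOfEllipticCurve` (child of `PublishedInputsBiquadratic`, item 20243, binder
`h6` of `closes`, whose sixth conjunct is `exists_isNewformOf`). This file records, as kernel-checked one-liners:

* § 1 `ModularityNewformExists ↔ exists_isNewformOf ↔ NewformOfEllipticCurve` (`Iff.rfl`), both directions as
  implications (`modularityNewformExists_of_exists_isNewformOf` is the «B19 reduce» of INPUTS-LIST-1), and
  `↔ existsUnique_isNewformOf` (the `∃!` form, Diamond–Shurman Thm. 8.8.1/8.8.3 with the `q`-expansion principle,
  tree `existsUnique_isNewformOf_iff`);
* § 2 `PublishedInputsBiquadratic → ModularityNewformExists`: inside `closes` the binder `h6` already carries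
  item 19216's content, so the route DISPLAYS ONE modularity input (19382), not two;
* § 3 the glue of the 20242 split RE-KEYED on item 19382 resp. on `h6`
  (`MazurManinOdd → AbbesUllmoManinGood → CesnaviciusManinTwo → NewformOfEllipticCurve → ManinDatumSupercuspidalCMInert
  → ManinDatumFiveSevenCMInert`, and the same with `PublishedInputsBiquadratic` in the fourth slot), so that a
  planner `--resplit` of 20242 dropping the child 19216 has its glue proof in the tree already;
* § 4 the twin decl of the SAME item in the draft route `PadicCornerSqueeze` (`Modularity`, identical text) agrees
  with all of the above (`Iff.rfl`).

HONEST FRAMING.  Definitional bookkeeping over landed theorems: every theorem here is either an `Iff.rfl`/identity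
or CONDITIONAL on modularity (`exists_isNewformOf`, an UNPROVED named fact of size XL — Wiles 1995, Taylor–Wiles
1995, BCDT 2001). NO item is closed by this file (item 19216 closes only on its own signature, i.e. on a proof
of modularity); it makes a conditional line shorter AS TYPED, nothing more. THEOREMS ONLY (no definition, no new
named fact, no `sorry`). BSD is not proved by any of this.

References: [DiamondShurman2005] Thm. 8.8.1, Thm. 8.8.3, §5.8; [BCDTJAMS2001] Thm. A; [Wiles1995]; [TaylorWiles1995];
[Carayol1986] (level = conductor); [Mazur1978] Cor. 4.1, [AbbesUllmo1996] Thm. A, [Cesnavicius2018] Thm. 1.2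
(the other three children of the split, context only).
-/

set_option autoImplicit false
-- the directory name repeats the summit name (`Summit.BirchSwinnertonDyer.BirchSwinnertonDyer.…`), as in every sibling file
set_option linter.dupNamespace false

namespace Summit.BirchSwinnertonDyer.BirchSwinnertonDyer.Theorems.BiquadraticEisensteinDescentModularityNewformExists

open Summit.BirchSwinnertonDyer.BirchSwinnertonDyer.Theses.BiquadraticEisensteinDescent
open Literature.NumberTheory.EllipticCurves.ModularForms (exists_isNewformOf existsUnique_isNewformOf
  existsUnique_isNewformOf_iff)
open Summit.BirchSwinnertonDyer.Rank1Residual.WAll (maninDatumFiveSevenCMInert_of_facts_of_supercuspidalResidual)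

/-! ## § 1 Item 19216 is item 19382, definitionally -/

/-- **Item 19216 ↔ the Literature named fact**: `ModularityNewformExists ↔ ModularForms.exists_isNewformOf`
(Modularity Theorem, Version `L`). The two sides are the same term (`Iff.rfl`): the route states inline what
the Literature states by name. [cite: DiamondShurman2005, Thm. 8.8.3] -/
theorem modularityNewformExists_iff_exists_isNewformOf : ModularityNewformExists ↔ exists_isNewformOf :=
  Iff.rfl

/-- **B19 reduce** (INPUTS-LIST-1 §1C.3): modularity by name ⟹ item 19216 `ModularityNewformExists`.
Conditional on `exists_isNewformOf` (BCDT 2001 Thm. A, unproved in the tree); closes nothing.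
[cite: BCDTJAMS2001, Thm. A] -/
theorem modularityNewformExists_of_exists_isNewformOf (h : exists_isNewformOf) : ModularityNewformExists := h

/-- Conversely item 19216 ⟹ the named fact `exists_isNewformOf` (so either may be displayed for the other).
[folklore] -/
theorem exists_isNewformOf_of_modularityNewformExists (h : ModularityNewformExists) : exists_isNewformOf := h

/-- **Item 19216 ↔ item 19382** inside route BED: `ModularityNewformExists ↔ NewformOfEllipticCurve`
(`NewformOfEllipticCurve := exists_isNewformOf`); `Iff.rfl`. [folklore] -/
theorem modularityNewformExists_iff_newformOfEllipticCurve : ModularityNewformExists ↔ NewformOfEllipticCurve :=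
  Iff.rfl

/-- Item 19382 `NewformOfEllipticCurve` ⟹ item 19216 `ModularityNewformExists`. Conditional; closes nothing.
[folklore] -/
theorem modularityNewformExists_of_newformOfEllipticCurve (h : NewformOfEllipticCurve) : ModularityNewformExists := h

/-- Item 19216 `ModularityNewformExists` ⟹ item 19382 `NewformOfEllipticCurve`. Conditional; closes nothing.
[folklore] -/
theorem newformOfEllipticCurve_of_modularityNewformExists (h : ModularityNewformExists) : NewformOfEllipticCurve := h

/-- **Item 19216 ↔ the `∃!` form of modularity** `existsUnique_isNewformOf` (Diamond–Shurman Thm. 8.8.1 /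
8.8.3 at level `N_E`): uniqueness of the newform of `W` is the `q`-expansion principle
(`IsNewformOf.unique`), tree `existsUnique_isNewformOf_iff`. [cite: DiamondShurman2005, Thm. 8.8.3] -/
theorem modularityNewformExists_iff_existsUnique_isNewformOf :
    ModularityNewformExists ↔ existsUnique_isNewformOf :=
  existsUnique_isNewformOf_iff.symm

/-- The `∃!` form ⟹ item 19216. Conditional; closes nothing. [cite: DiamondShurman2005, Thm. 8.8.3] -/
theorem modularityNewformExists_of_existsUnique_isNewformOf (h : existsUnique_isNewformOf) :
    ModularityNewformExists :=
  modularityNewformExists_iff_existsUnique_isNewformOf.mpr h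

/-! ## § 2 Inside `closes`: the binder `h6 : PublishedInputsBiquadratic` already supplies item 19216 -/

/-- **`PublishedInputsBiquadratic → ModularityNewformExists`**: the sixth conjunct of the classical-inputs
binder `h6` (item 20243) of the route's deciding theorem is `exists_isNewformOf`, i.e. item 19216. Hence,
granted `h6`, the modularity child of the 20242 split is not an independent displayed input. Conditional;
closes nothing. [folklore] -/
theorem modularityNewformExists_of_publishedInputsBiquadratic (h : PublishedInputsBiquadratic) :
    ModularityNewformExists :=
  h.2.2.2.2.2.1

/-- The same conjunct read as item 19382: `PublishedInputsBiquadratic → NewformOfEllipticCurve` (the landed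
glue `PublishedInputsBiquadraticOfParts` goes the other way). [folklore] -/
theorem newformOfEllipticCurve_of_publishedInputsBiquadratic (h : PublishedInputsBiquadratic) :
    NewformOfEllipticCurve :=
  h.2.2.2.2.2.1

/-! ## § 3 The glue of the 20242 split re-keyed on item 19382 / on `h6` -/

/-- **Glue of the `ManinDatumFiveSevenCMInert` split with the modularity child displayed BY NAME (item 19382)**:
`MazurManinOdd → AbbesUllmoManinGood → CesnaviciusManinTwo → NewformOfEllipticCurve →
ManinDatumSupercuspidalCMInert → ManinDatumFiveSevenCMInert` — the SAME one-line term as the landed glue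
`maninDatumFiveSevenCMInertOfParts_holds` (item 20114), namely the Theses-free alt-closer
`WAll.maninDatumFiveSevenCMInert_of_facts_of_supercuspidalResidual` (Stevens 1989 / Mazur for the `Iₙ*` cells,
proved in the tree), at the definitionally equal fourth hypothesis. A planner re-split of 20242 replacing child 19216 by 19382 may
cite this theorem as its glue proof. [folklore] -/
theorem maninDatumFiveSevenCMInert_of_parts_newformOfEllipticCurve :
    MazurManinOdd → AbbesUllmoManinGood → CesnaviciusManinTwo → NewformOfEllipticCurve →
      ManinDatumSupercuspidalCMInert → ManinDatumFiveSevenCMInert :=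
  fun hM hAU hC2 hnf hRes ↦ maninDatumFiveSevenCMInert_of_facts_of_supercuspidalResidual hM hAU hC2 hnf hRes

/-- **The same glue with the route binder `h6` in the modularity slot**:
`MazurManinOdd → AbbesUllmoManinGood → CesnaviciusManinTwo → PublishedInputsBiquadratic →
ManinDatumSupercuspidalCMInert → ManinDatumFiveSevenCMInert` — so, inside `closes`, the binder `h5` needs from
the 20242 split only Mazur, Abbes–Ullmo, Česnavičius and the supercuspidal residual (item 20111) beyond `h6`.
[folklore] -/
theorem maninDatumFiveSevenCMInert_of_parts_publishedInputsBiquadratic :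
    MazurManinOdd → AbbesUllmoManinGood → CesnaviciusManinTwo → PublishedInputsBiquadratic →
      ManinDatumSupercuspidalCMInert → ManinDatumFiveSevenCMInert :=
  fun hM hAU hC2 h6 hRes ↦
    maninDatumFiveSevenCMInert_of_facts_of_supercuspidalResidual hM hAU hC2 h6.2.2.2.2.2.1 hRes

/-- The same glue with modularity as the Literature NAMED FACT in the fourth slot (for an assembly that holds
`exists_isNewformOf` directly). [folklore] -/
theorem maninDatumFiveSevenCMInert_of_parts_exists_isNewformOf :
    MazurManinOdd → AbbesUllmoManinGood → CesnaviciusManinTwo → exists_isNewformOf →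
      ManinDatumSupercuspidalCMInert → ManinDatumFiveSevenCMInert :=
  fun hM hAU hC2 hnf hRes ↦ maninDatumFiveSevenCMInert_of_facts_of_supercuspidalResidual hM hAU hC2 hnf hRes

/-! ## § 4 The twin decl of item 19216 in the draft route `PadicCornerSqueeze` -/

/-- Item 19216 is shared with the draft route `PadicCornerSqueeze`, decl `Modularity`, with IDENTICAL text:
`PadicCornerSqueeze.Modularity ↔ ModularityNewformExists` by `Iff.rfl`. [folklore] -/
theorem padicCornerSqueeze_modularity_iff_modularityNewformExists :
    Summit.BirchSwinnertonDyer.BirchSwinnertonDyer.Theses.PadicCornerSqueeze.Modularity ↔ ModularityNewformExists :=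
  Iff.rfl

/-- `PadicCornerSqueeze.Modularity ↔ ModularForms.exists_isNewformOf` (`Iff.rfl`).
[cite: DiamondShurman2005, Thm. 8.8.3] -/
theorem padicCornerSqueeze_modularity_iff_exists_isNewformOf :
    Summit.BirchSwinnertonDyer.BirchSwinnertonDyer.Theses.PadicCornerSqueeze.Modularity ↔ exists_isNewformOf :=
  Iff.rfl

/-- Modularity by name ⟹ `PadicCornerSqueeze.Modularity`. Conditional on `exists_isNewformOf`; closes nothing.
[cite: BCDTJAMS2001, Thm. A] -/
theorem padicCornerSqueeze_modularity_of_exists_isNewformOf (h : exists_isNewformOf) :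
    Summit.BirchSwinnertonDyer.BirchSwinnertonDyer.Theses.PadicCornerSqueeze.Modularity := h

end Summit.BirchSwinnertonDyer.BirchSwinnertonDyer.Theorems.BiquadraticEisensteinDescentModularityNewformExists
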